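import Summits.QuantumFields.BalabanUV.T4Continuum.Spine.NE3.FrameNormalisationOneLevel
import HarnessLib

/-!
# T⁴ programme, node NE3 — census R50 open half (M1), FIRST BRICK: the one-step double-bar average under an ARBITRARY moving-frame gauge — EXACT representation
# `(V₁^{v})‾‾ = (D_δ)^{v_corner}` with `D_δ` the double-bar average built with the `δ`-TWISTED block frames, `δ` = the covariant block oscillation of `v`
# (`FrameNormalisationDefect`)

Cell `pub-balaban-gaps` (track G2, seat ne3, generation 11), row NE3; census `HOME/ne/NE3.md` §4 R50, §17 (M1).  `FrameNormalisationOneLevel.dbavgCov_mgauge_of_blockCovConst`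
says: under a gauge `v` that is block-covariantly constant relative to `V₀` (`R(V₀(Γ_{y,x})) v(x) = v(y)` on every block) the one-step double-bar average (89) transforms by
moving frames at the corners — EXACTLY; this is what makes the frame condition solvable at every order (`FrameNormalisation`), but only by a piecewise covariantly-constant
gauge, which jumps across block faces (R50's located limit).  The (1.36)-compatible realisation uses a SMOOTH gauge, for which exact covariance fails; census (M1) asks for
the size of the failure.  This module gives its EXACT ALGEBRAIC FORM, for every gauge `v` (no smallness, no unitarity; group algebra over [Balaban1985Averaging] (57)–(59),
(62), (82), (89), (93)):

* the COVARIANT BLOCK OSCILLATION of `v` at `y` along `Γ = Γ_{y,x}`: `δ_v(y,Γ) := v(y)⁻¹ · R(V₀(Γ)) v(x)` (`= 1` for every tree contour of every block iff `v` is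
  block-covariantly constant) — written inline, no definition;
* §1 `tHol_mgauge_general` — `(R_{0,y}V₁^{v})(Γ) = R(v(y)) [(R_{0,y}V₁)(Γ) · δ_v(y,Γ)⁻¹]` ((58)∕(93) `B7Eq92Concrete.tHol_mgauge`, regrouped);
  `Fcov_mgauge_general` ∕ `wframe_mgauge_general` — the exponent (62) and the block frame (82) of `V₁^{v}` are the `R(v(y))`-conjugates of the `δ`-TWISTED exponent ∕ frame
  `F_δ(y) := Σ_{x∈B(y)} L^{−d} log[(R_{0,y}V₁)(Γ_{y,x}) · δ_v(y,Γ_{y,x})⁻¹]`, `w_δ := exp F_δ` ((57): `log`, `exp` are conjugation-covariant);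
* §2 `dbavgCov_mgauge_of_wframe` — for ANY frames `w′` with `w(V₁^{v})(y) = R(v(y)) w′(y)`: `(V₁^{v})‾‾(c) = v(c₋) · [w′(c₋)⁻¹ Ṽ₁(c) R̄_{0,c} w′(c₊)] · (R̄_{0,c} v(c₊))⁻¹`
  ((89) with (59)∕(93) `tild_mgauge`); hence **`dbavgCov_mgauge_general`**: the one-step double-bar average of `V₁^{v}` is the moving-frame transform, BY THE CORNER VALUES of
  `v` relative to `V̄₀`, of the `δ`-framed double-bar average `D_δ(c) := w_δ(c₋)⁻¹ Ṽ₁(c) R̄_{0,c} w_δ(c₊)` — and `D_δ = V̿₁` when `δ_v ≡ 1` (`dbavgCov_mgauge_of_blockCovConst` recovered: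
  `dbavgCov_mgauge_general_of_blockCovConst`).

So the COVARIANCE DEFECT of (89) under a general gauge is exactly `D_δ − V̿₁`: the response of the block frames (82) to right-multiplying each twisted holonomy
`(R_{0,y}V₁)(Γ_{y,x})` by `δ_v(y,Γ_{y,x})⁻¹`; its SIZE (Lipschitz bounds of `log` on the `‖· − 1‖ < 1` ball and of `exp`: `‖D_δ(c) − V̿₁(c)‖ ≲ sup‖δ_v − 1‖`, the linear
response that the fixed point of (M1) inverts) is the next brick, not this file.

HONEST FRAMING (page 1).  Group algebra on the tree's formal objects (0 def, 0 sorry, no estimate); nothing of Bałaban's asserted; the smooth∕joint realisation of (1.37) with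
(1.36)∕(1.38) (census R50 open half, [Balaban1985RegularSpaces] Sect. E (1.100)) is NOT done here; **NE3 NOT proved**; `PairLandauGaugeB8Avg` and the covariant root NOT
proved; spine PROVED 0∕9; finite T⁴ rung (B)+1 — NOT continuum YM on ℝ⁴, NOT infinite volume, NOT mass gap, NOT `BetaPertH`, NOT Clay.  HONEST DEPENDENCY: continuum YM on
T⁴ ⇐ BetaPertH ∧ nine spine estimates (0/9 proved); BetaPertH ⇐ (D1) ∧ (D4) ∧ CAP+tail; G-an2-4 gates asym, D1 and NE2/3/4.  PLACEMENT:
`Summits/QuantumFields/BalabanUV/T4Continuum/Spine/NE3/`; imports `FrameNormalisationOneLevel` only.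

References: [Balaban1985Averaging] T. Bałaban, *Averaging operations for lattice gauge theories*, CMP 98 (1985) 17–51: (57)–(59) p. 27, (62) p. 28, (82) p. 30, (89) p. 31,
(93) p. 32; [Balaban1985RegularSpaces] CMP 99 (1985), (1.29) p. 80, (1.36)–(1.37) p. 82, (1.100) p. 98.
-/

set_option autoImplicit false

open scoped BigOperators Matrix Matrix.Norms.L2Operator
open NormedSpace

namespace Summit.QuantumFields.BalabanUV.T4Continuum.NE3.FrameNormalisationDefect

open Literature.MathematicalPhysics.QuantumFieldTheory.Balaban1983to89
open B7Prop1Explicit B7Prop2Explicit MatrixLog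
open B7Eq92Concrete (Rc Rc_apply mgauge mgauge_apply tHol tHol_mgauge Fcov wframe tild tild_mgauge dbavgCov dbavgCov_apply mlog_Rc expUnit_conj)
open NE3.FrameNormalisationOneLevel (dbavgCov_mgauge_of_blockCovConst)

noncomputable section

variable {d : ℕ} {n : Type*} [Fintype n] [DecidableEq n]

/-! ## §1 Twisted holonomy, exponent (62) and block frame (82) of `V₁^{v}` for an ARBITRARY gauge `v`: conjugates of the `δ`-twisted objects -/

/-- **TWISTED HOLONOMY OF `V₁^{v}`, REGROUPED**: `(R_{0,y}V₁^{v})(Γ) = R(v(y)) [(R_{0,y}V₁)(Γ) · δ_v(y,Γ)⁻¹]` with the covariant oscillation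
`δ_v(y,Γ) = v(y)⁻¹ · R(V₀(Γ)) v(y + disp Γ)` ((58)∕(93), `tHol_mgauge`). [folklore] -/
theorem tHol_mgauge_general (V₀ V₁ : Site d → Fin d → (Matrix n n ℂ)ˣ) (v : Site d → (Matrix n n ℂ)ˣ) (y : Site d) (w : List (Letter d)) :
    tHol V₀ (mgauge V₀ v V₁) y w = Rc (v y) (tHol V₀ V₁ y w * ((v y)⁻¹ * Rc (hol V₀ y w) (v (y + disp w)))⁻¹) := by
  rw [tHol_mgauge]
  simp only [Rc_apply, mul_inv_rev, inv_inv]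
  group

/-- **THE EXPONENT (62) OF `V₁^{v}` IS THE CONJUGATE OF THE `δ`-TWISTED EXPONENT**:
`F(V₁^{v})(y) = v(y) · (Σ_r L^{−d} log[(R_{0,y}V₁)(Γ_{y,y+r}) · δ_v(y,Γ_{y,y+r})⁻¹]) · v(y)⁻¹` ((57): `log R(X)Y = R(X) log Y`, `mlog_Rc`). [folklore] -/
theorem Fcov_mgauge_general (L : ℕ) (V₀ V₁ : Site d → Fin d → (Matrix n n ℂ)ˣ) (v : Site d → (Matrix n n ℂ)ˣ) (y : Site d) :
    Fcov L V₀ (mgauge V₀ v V₁) y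
      = (v y : Matrix n n ℂ) *
          (∑ r : Fin d → Fin L, (((L : ℝ) ^ d)⁻¹) •
            mlog ((tHol V₀ V₁ y (treeWord (boxVec L r)) *
              ((v y)⁻¹ * Rc (hol V₀ y (treeWord (boxVec L r))) (v (y + boxVec L r)))⁻¹ : (Matrix n n ℂ)ˣ) : Matrix n n ℂ)) *
          ((v y)⁻¹ : (Matrix n n ℂ)ˣ) := by
  unfold Fcov
  rw [Finset.mul_sum, Finset.sum_mul]
  refine Finset.sum_congr rfl fun r _ => ?_
  rw [tHol_mgauge_general, disp_treeWord, mlog_Rc, ← smul_mul_assoc, ← mul_smul_comm]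

/-- **THE BLOCK FRAME (82) OF `V₁^{v}` IS THE CONJUGATE OF THE `δ`-TWISTED FRAME**: `w(V₁^{v})(y) = R(v(y)) exp F_δ(y)` ((57) for `exp`, `expUnit_conj`). [folklore] -/
theorem wframe_mgauge_general (L : ℕ) (V₀ V₁ : Site d → Fin d → (Matrix n n ℂ)ˣ) (v : Site d → (Matrix n n ℂ)ˣ) (y : Site d) :
    wframe L V₀ (mgauge V₀ v V₁) y
      = Rc (v y) (expUnit (∑ r : Fin d → Fin L, (((L : ℝ) ^ d)⁻¹) •
          mlog ((tHol V₀ V₁ y (treeWord (boxVec L r)) *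
            ((v y)⁻¹ * Rc (hol V₀ y (treeWord (boxVec L r))) (v (y + boxVec L r)))⁻¹ : (Matrix n n ℂ)ˣ) : Matrix n n ℂ))) := by
  unfold wframe
  rw [Fcov_mgauge_general, expUnit_conj]

/-- For a gauge block-covariantly constant on the block of `y` the `δ`-twisted exponent is the plain one (`δ_v ≡ 1` there). [folklore] -/
theorem twistedSum_eq_Fcov_of_blockCovConst (L : ℕ) (V₀ V₁ : Site d → Fin d → (Matrix n n ℂ)ˣ) (v : Site d → (Matrix n n ℂ)ˣ) (y : Site d)
    (hv : ∀ r : Fin d → Fin L, Rc (hol V₀ y (treeWord (boxVec L r))) (v (y + boxVec L r)) = v y) :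
    (∑ r : Fin d → Fin L, (((L : ℝ) ^ d)⁻¹) •
        mlog ((tHol V₀ V₁ y (treeWord (boxVec L r)) *
          ((v y)⁻¹ * Rc (hol V₀ y (treeWord (boxVec L r))) (v (y + boxVec L r)))⁻¹ : (Matrix n n ℂ)ˣ) : Matrix n n ℂ))
      = Fcov L V₀ V₁ y := by
  unfold Fcov
  refine Finset.sum_congr rfl fun r _ => ?_
  rw [hv r, inv_mul_cancel, inv_one, mul_one]

/-! ## §2 The one-step double-bar average (89) of `V₁^{v}`: moving-frame transform of the `δ`-framed double-bar average -/

/-- **(89) UNDER AN ARBITRARY GAUGE, ABSTRACT FRAMES**: if the block frames of `V₁^{v}` are `R(v(y)) w′(y)` for some `w′`, then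
`(V₁^{v})‾‾(c) = v(c₋) · [w′(c₋)⁻¹ · Ṽ₁(c) · R̄_{0,c} w′(c₊)] · (R̄_{0,c} v(c₊))⁻¹` (`c = ⟨q, q + Le_κ⟩`; (59)∕(93) `tild_mgauge` and group algebra). [folklore] -/
theorem dbavgCov_mgauge_of_wframe (L : ℕ) (V₀ V₁ : Site d → Fin d → (Matrix n n ℂ)ˣ) (v : Site d → (Matrix n n ℂ)ˣ) {w' : Site d → (Matrix n n ℂ)ˣ}
    (hw : ∀ y : Site d, wframe L V₀ (mgauge V₀ v V₁) y = Rc (v y) (w' y)) (q : Site d) (κ : Fin d) :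
    dbavgCov L V₀ (mgauge V₀ v V₁) q κ
      = v q * ((w' q)⁻¹ * tild L V₀ V₁ q κ * Rc (bavg L V₀ q κ) (w' (q + (L : ℤ) • e κ))) * (Rc (bavg L V₀ q κ) (v (q + (L : ℤ) • e κ)))⁻¹ := by
  rw [dbavgCov_apply, hw, hw, tild_mgauge]
  simp only [Rc_apply, map_mul, map_inv, mul_inv_rev, inv_inv]
  group

/-- **THE ONE-STEP DOUBLE-BAR AVERAGE OF `V₁^{v}` FOR AN ARBITRARY GAUGE `v`** — EXACT: with the `δ`-twisted frames `w_δ(y) := exp F_δ(y)`,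
`(V₁^{v})‾‾(c) = v(c₋) · D_δ(c) · (R̄_{0,c} v(c₊))⁻¹`, `D_δ(c) := w_δ(c₋)⁻¹ · Ṽ₁(c) · R̄_{0,c} w_δ(c₊)` — the moving-frame transform by the corner values of `v` (relative to `V̄₀`) of
the `δ`-FRAMED double-bar average.  The covariance defect of (89) is therefore exactly `D_δ − V̿₁`. [folklore] -/
theorem dbavgCov_mgauge_general (L : ℕ) (V₀ V₁ : Site d → Fin d → (Matrix n n ℂ)ˣ) (v : Site d → (Matrix n n ℂ)ˣ) (q : Site d) (κ : Fin d) :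
    dbavgCov L V₀ (mgauge V₀ v V₁) q κ
      = v q *
          ((expUnit (∑ r : Fin d → Fin L, (((L : ℝ) ^ d)⁻¹) •
              mlog ((tHol V₀ V₁ q (treeWord (boxVec L r)) *
                ((v q)⁻¹ * Rc (hol V₀ q (treeWord (boxVec L r))) (v (q + boxVec L r)))⁻¹ : (Matrix n n ℂ)ˣ) : Matrix n n ℂ)))⁻¹ *
            tild L V₀ V₁ q κ *
            Rc (bavg L V₀ q κ) (expUnit (∑ r : Fin d → Fin L, (((L : ℝ) ^ d)⁻¹) •
              mlog ((tHol V₀ V₁ (q + (L : ℤ) • e κ) (treeWord (boxVec L r)) *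
                ((v (q + (L : ℤ) • e κ))⁻¹ * Rc (hol V₀ (q + (L : ℤ) • e κ) (treeWord (boxVec L r)))
                  (v (q + (L : ℤ) • e κ + boxVec L r)))⁻¹ : (Matrix n n ℂ)ˣ) : Matrix n n ℂ)))) *
          (Rc (bavg L V₀ q κ) (v (q + (L : ℤ) • e κ)))⁻¹ :=
  dbavgCov_mgauge_of_wframe L V₀ V₁ v (fun y => wframe_mgauge_general L V₀ V₁ v y) q κ

/-- **CONSISTENCY WITH `FrameNormalisationOneLevel`**: when `v` is block-covariantly constant on the blocks of both endpoints of `c`, the `δ`-framed double-bar average IS `V̿₁(c)`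
and `dbavgCov_mgauge_general` reduces to `dbavgCov_mgauge_of_blockCovConst`. [folklore] -/
theorem dbavgCov_mgauge_general_of_blockCovConst (L : ℕ) (V₀ V₁ : Site d → Fin d → (Matrix n n ℂ)ˣ) (v : Site d → (Matrix n n ℂ)ˣ) (q : Site d) (κ : Fin d)
    (hq : ∀ r : Fin d → Fin L, Rc (hol V₀ q (treeWord (boxVec L r))) (v (q + boxVec L r)) = v q)
    (hq' : ∀ r : Fin d → Fin L,
      Rc (hol V₀ (q + (L : ℤ) • e κ) (treeWord (boxVec L r))) (v (q + (L : ℤ) • e κ + boxVec L r)) = v (q + (L : ℤ) • e κ)) :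
    (expUnit (∑ r : Fin d → Fin L, (((L : ℝ) ^ d)⁻¹) •
        mlog ((tHol V₀ V₁ q (treeWord (boxVec L r)) *
          ((v q)⁻¹ * Rc (hol V₀ q (treeWord (boxVec L r))) (v (q + boxVec L r)))⁻¹ : (Matrix n n ℂ)ˣ) : Matrix n n ℂ)))⁻¹ *
      tild L V₀ V₁ q κ *
      Rc (bavg L V₀ q κ) (expUnit (∑ r : Fin d → Fin L, (((L : ℝ) ^ d)⁻¹) •
        mlog ((tHol V₀ V₁ (q + (L : ℤ) • e κ) (treeWord (boxVec L r)) *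
          ((v (q + (L : ℤ) • e κ))⁻¹ * Rc (hol V₀ (q + (L : ℤ) • e κ) (treeWord (boxVec L r)))
            (v (q + (L : ℤ) • e κ + boxVec L r)))⁻¹ : (Matrix n n ℂ)ˣ) : Matrix n n ℂ)))
      = dbavgCov L V₀ V₁ q κ := by
  rw [twistedSum_eq_Fcov_of_blockCovConst L V₀ V₁ v q hq, twistedSum_eq_Fcov_of_blockCovConst L V₀ V₁ v _ hq', dbavgCov_apply]
  rfl

end

end Summit.QuantumFields.BalabanUV.T4Continuum.NE3.FrameNormalisationDefect
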